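import Summits.CriticalPhenomena.PercolationContinuityZ3.Theorems.PercNearOneGluingNoHeavyQuantAD3FrechetHH
import Summits.CriticalPhenomena.PercolationContinuityZ3.Theorems.PercNearOneGluingNoHeavyQuantAD3FrechetLL
import HarnessLib

/-!
# QUANT lane R8, T-DEC, ROUTE 2: the Fréchet laws of a HEAVY pair and a LIGHT admissible pair are admissible (cell `AD3FrechetCell`,
# kind H⊗L2)

builds on p205010 (kernel theorem, internal audit signed; external expert review pending)

Support file (`--supports stmt-CriticalPhenomena-4575`), QUANT lane, seat prim-quant-arm-2 (gen 37), rung R8 of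
`run/shared/lean/prim/quant/LADDER.md`; fourth kernel piece of the lead g35 ruling "arm-2 owns `AD3FrechetCell`" (INBOX l.1198); uses
`…QuantAD3FrechetHH` (the big-`frCt` core, whose small-spread gate is free) and `…QuantAD3FrechetLL` (`triple_gate_decAt_of_noLow`).
Theorems only, standard axioms, no sorries.

THE SETTING.  `A = {l₁,h₁;α}` HEAVY (`y ≤ qα`), `B = {l₂,h₂;β}` LIGHT (`qβ < y`) and admissible — so `qT₂ ≤ 2l₂` (`lightPair_two_lo_ge`) and
`1 ≤ l₂`; both top-affordable; `0 < y < q ≤ 1`; `τ = q(T₁+T₂)`.  Since `β < α`, `frCo = TR[l₁+l₂, h₁+l₂, h₁+h₂; 1−α, α−β, β]` (top mass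
`qβ` — LIGHT, so no heavy-top shortcut).  KEY FACTS: the middle atom `c = h₁+l₂` is never low (`2h₁ ≥ 2T₁ ≥ qT₁`, `2l₂ ≥ qT₂`), and the
credit gate `g` of the arc (`a = l₁+l₂` → `c`) satisfies `g ≤ qα` (`ρ = (τ − 2a)/(h₁−l₁) = qα − [(2−q)l₁ + (2l₂ − qT₂)]/(h₁−l₁) ≤ qα`, and
`y ≤ qα`), whence the corner inequality `g(y − qβ) ≤ y(qα − qβ)` (`hl_corner_key`).  So:
* `frCo`: `2a ≥ τ` ⟹ no low atom; `τ < a + c` ⟹ the corner of arm-2's criterion (H1 = heaviness, C1 = the key); `a + c ≤ τ` forces `qα = 1`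
  and H3 holds trivially — `frCo_gate_decAt_HL`.
* small `frCt` (`α+β ≤ 1`) `= TR[l₁+l₂, l₁+h₂, h₁+l₂; 1−α−β, β, α]`: if `l₁+h₂ ≤ h₁+l₂` its top carries `qα ≥ y` (`triple_gate_decAt_of_heavyTop`);
  else the same corner with C1 `g(y − qβ) ≤ y·qα` — `frCtSmall_gate_decAt_HL`.
* big `frCt` (`α+β ≥ 1`) `= TR[l₁+h₂, h₁+l₂, h₁+h₂; 1−α, 1−β, α+β−1]`: if `h₁+l₂ ≤ l₁+h₂` every atom is `≥ h₁+l₂`, not low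
  (`triple_gate_decAt_of_noLow`); else the normal form of `…FrechetHH` with the LARGE spread `h₁−l₁` carrying the heavy gate
  (`frCtBig_gate_decAt_core`) — `frCtBig_gate_decAt_HL`.
EXACT EVIDENCE (arm-2 g37 `code/frlight.py`): 10 195 H⊗L2 / L2⊗H Fréchet laws, all admissible, arm-2's criterion = the exact DEC LP in every
instance, corner slack down to exactly `0` (threshold-heavy `α`); lead g35: 26 896 / 0.

[this work]; Fréchet template: lead g35; `lightPair_two_lo_ge`/`lightPair_lo_pos`: typer g31 (this lane).  The gluing rows served
[cite: KozmaNitzan2024, Conjecture 3 (p. 15)]; product measure [cite: Grimmett1999, §1.3 p. 10].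
-/

noncomputable section

namespace Summit.CriticalPhenomena.PercolationContinuityZ3.Theorems

namespace Quant

open Finset

/-- two-point law notation `TP[lo, hi, g, h] = g·[h = hi] + (1 − g)·[h = lo]` (as in the lane's other files). -/
local notation3 "TP[" lo ", " hi ", " g ", " h "]" =>
  (g : ℝ) * (if (h : ℕ) = (hi : ℕ) then (1 : ℝ) else 0) + (1 - (g : ℝ)) * (if (h : ℕ) = (lo : ℕ) then (1 : ℝ) else 0)

/-- three-atom law notation `TR[s₁, s₂, s₃, p₁, p₂, p₃, h] = p₁·[h = s₁] + p₂·[h = s₂] + p₃·[h = s₃]`. -/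
local notation3 "TR[" s₁ ", " s₂ ", " s₃ ", " p₁ ", " p₂ ", " p₃ ", " h "]" =>
  (p₁ : ℝ) * (if (h : ℕ) = (s₁ : ℕ) then (1 : ℝ) else 0) + (p₂ : ℝ) * (if (h : ℕ) = (s₂ : ℕ) then (1 : ℝ) else 0)
    + (p₃ : ℝ) * (if (h : ℕ) = (s₃ : ℕ) then (1 : ℝ) else 0)

/-- four-atom law notation `QD[a, b, c, Z, A, B, C, h] = Z·[h = 0] + A·[h = a] + B·[h = b] + C·[h = c]`. -/
local notation3 "QD[" a ", " b ", " c ", " Z ", " A ", " B ", " C ", " h "]" =>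
  (Z : ℝ) * (if (h : ℕ) = (0 : ℕ) then (1 : ℝ) else 0) + (A : ℝ) * (if (h : ℕ) = (a : ℕ) then (1 : ℝ) else 0)
    + (B : ℝ) * (if (h : ℕ) = (b : ℕ) then (1 : ℝ) else 0) + (C : ℝ) * (if (h : ℕ) = (c : ℕ) then (1 : ℝ) else 0)

namespace LawDec

/-! ### Scalar lemmas -/

/-- the credit gate is at most the heavy gate: `max(ρ, y² + (1−y)ρ) ≤ α̂` when `ρ ≤ α̂`, `y ≤ α̂`, `0 ≤ y ≤ 1`. [this work] -/
theorem hl_gate_le (y ah ρ : ℝ) (hy0 : 0 ≤ y) (hy1 : y ≤ 1) (hya : y ≤ ah) (hρa : ρ ≤ ah) :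
    max ρ (y ^ 2 + (1 - y) * ρ) ≤ ah := by
  refine max_le hρa ?_
  nlinarith [mul_le_mul_of_nonneg_left hya hy0, mul_le_mul_of_nonneg_left hρa (sub_nonneg.2 hy1)]

/-- the H⊗L corner inequality: `g(y − β̂) ≤ y(α̂ − β̂)` when `g ≤ α̂`, `y ≤ α̂`, `0 ≤ β̂ ≤ y`. [this work] -/
theorem hl_corner_key (y ah bh g : ℝ) (hbh0 : 0 ≤ bh) (hby : bh ≤ y) (hya : y ≤ ah) (hga : g ≤ ah) :
    g * (y - bh) ≤ y * (ah - bh) := by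
  nlinarith [mul_le_mul_of_nonneg_right hga (sub_nonneg.2 hby), mul_le_mul_of_nonneg_right hya hbh0]

/-- from the key inequality to the C1 form of arm-2's criterion: `g(y − C) ≤ yB`, `0 < g`, `Z + A + B + C = 1` ⟹
`y(Z + A − B/(g/(1−g))) ≤ (1−y)C`. [this work] -/
theorem corner_C1_of_key (y Z A B C g : ℝ) (hg0 : 0 < g) (hsum : Z + A + B + C = 1)
    (hkey : g * (y - C) ≤ y * B) : y * (Z + A - B / (g / (1 - g))) ≤ (1 - y) * C := by
  rw [div_div_eq_mul_div]
  have e1 : y * (Z + A - B * (1 - g) / g) = (y * (g * (Z + A + B) - B)) / g := by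
    field_simp
    ring
  rw [e1, div_le_iff₀ hg0, show Z + A + B = 1 - C by linarith]
  nlinarith [hkey]

/-- `ρ = (q·l₁ + α̂·k₁ + τ₂ − 2l₁ − 2l₂)/k₁ ≤ α̂` when `τ₂ ≤ 2l₂`, `q ≤ 2`, `l₁ ≥ 0`, `k₁ > 0`. [this work] -/
theorem hl_rho_le (q ah τ₂ l₁ l₂ k₁ : ℝ) (hq : q ≤ 2) (hl₁ : 0 ≤ l₁) (hk₁ : 0 < k₁) (h2l₂ : τ₂ ≤ 2 * l₂) :
    (q * l₁ + ah * k₁ + τ₂ - 2 * l₁ - 2 * l₂) / k₁ ≤ ah := by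
  rw [div_le_iff₀ hk₁]
  nlinarith

/-- the mean of a pair is at most its top, hence `q·T₁ ≤ h₁` (`0 ≤ q ≤ 1`, `0 ≤ α ≤ 1`, `0 ≤ l₁ ≤ h₁`). [folklore] -/
theorem gate_pairMean_le_hi (q α l₁ h₁ : ℝ) (hq0 : 0 ≤ q) (hq1 : q ≤ 1) (hα0 : 0 ≤ α) (hα1 : α ≤ 1) (hl0 : 0 ≤ l₁)
    (hl : l₁ ≤ h₁) : q * (l₁ + (h₁ - l₁) * α) ≤ h₁ := by
  have h1 : l₁ + (h₁ - l₁) * α ≤ h₁ := by nlinarith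
  have h2 : 0 ≤ l₁ + (h₁ - l₁) * α := by nlinarith
  nlinarith

/-- the degenerate sub-case of the H⊗L corner: `(l₁+l₂) + (h₁+l₂) ≤ q·T₁ + τ₂` with `τ₂ ≤ 2l₂` forces `q·α ≥ 1`. [this work] -/
theorem hl_degenerate (q α l₁ h₁ l₂ τ₂ : ℝ) (hq1 : q ≤ 1) (hl0 : 0 ≤ l₁) (hl : l₁ < h₁)
    (h2l₂ : τ₂ ≤ 2 * l₂) (hcomp : (l₁ + l₂) + (h₁ + l₂) ≤ q * (l₁ + (h₁ - l₁) * α) + τ₂) : 1 ≤ q * α := by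
  by_contra hlt
  rw [not_le] at hlt
  have h1 : q * α * (h₁ - l₁) < h₁ - l₁ := by nlinarith
  have h2 : q * l₁ ≤ l₁ := by nlinarith
  nlinarith

/-! ### The comonotone law -/

/-- **`frCo` of a heavy and a light admissible pair is admissible**: shape `TR[l₁+l₂, h₁+l₂, h₁+h₂; 1−α, α−β, β]` (`β ≤ α`). [this work] -/
theorem frCo_gate_decAt_HL (y q α β : ℝ) (M₁ M₂ l₁ h₁ l₂ h₂ : ℕ) (hy0 : 0 < y) (hyq : y < q) (hq1 : q ≤ 1)
    (hl₁ : l₁ < h₁) (hh₁ : h₁ ≤ M₁) (hl₂ : l₂ < h₂) (hh₂ : h₂ ≤ M₂) (hα1 : α ≤ 1) (hβ0 : 0 ≤ β) (hβ1 : β ≤ 1)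
    (hα : y ≤ q * α) (hβl : q * β < y)
    (hta₁ : y * (M₁ : ℝ) ≤ q * ((l₁ : ℝ) + ((h₁ : ℝ) - l₁) * α)) (hta₂ : y * (M₂ : ℝ) ≤ q * ((l₂ : ℝ) + ((h₂ : ℝ) - l₂) * β))
    (hD₂ : ∀ j', j' < M₂ → DECAt y j' M₂ (gate (fun h => TP[l₂, h₂, β, h]) q)) :
    ∀ j', j' < M₁ + M₂ → DECAt y j' (M₁ + M₂) (gate (fun h => TR[l₁ + l₂, h₁ + l₂, h₁ + h₂, 1 - α, α - β, β, h]) q) := by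
  have hq0 : 0 < q := lt_trans hy0 hyq
  have hy1 : y < 1 := lt_of_lt_of_le hyq hq1
  have h2l₂ := lightPair_two_lo_ge y q β M₂ l₂ h₂ hy1.le hl₂ hh₂ hβ0 hβ1 hβl hD₂
  have hl₂pos := lightPair_lo_pos y q β M₂ l₂ h₂ hy0 hl₂ hh₂ hβl hta₂
  have hβα : β ≤ α := by nlinarith
  obtain ⟨T, hT⟩ : ∃ T : ℝ, T = ((l₁ : ℝ) + ((h₁ : ℝ) - l₁) * α) + ((l₂ : ℝ) + ((h₂ : ℝ) - l₂) * β) := ⟨_, rfl⟩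
  have hta : y * ((M₁ + M₂ : ℕ) : ℝ) ≤ q * T := by rw [hT]; push_cast; linarith
  -- the gated law as a four-atom law with a zero atom
  have e : gate (fun h => TR[l₁ + l₂, h₁ + l₂, h₁ + h₂, 1 - α, α - β, β, h]) q
      = fun h => QD[l₁ + l₂, h₁ + l₂, h₁ + h₂, 1 - q, q * (1 - α), q * (α - β), q * β, h] := by
    funext h; simp only [gate]; split_ifs <;> ring
  rw [e]
  have hZ : 0 ≤ 1 - q := by linarith
  have hA : 0 ≤ q * (1 - α) := mul_nonneg hq0.le (by linarith)
  have hB : 0 ≤ q * (α - β) := mul_nonneg hq0.le (by linarith)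
  have hC : 0 ≤ q * β := mul_nonneg hq0.le hβ0
  have hsum : (1 - q) + q * (1 - α) + q * (α - β) + q * β = 1 := by ring
  have emean : ((l₁ + l₂ : ℕ) : ℝ) * (q * (1 - α)) + ((h₁ + l₂ : ℕ) : ℝ) * (q * (α - β)) + ((h₁ + h₂ : ℕ) : ℝ) * (q * β)
      = q * T := by rw [hT]; push_cast; ring
  have hta' : y * ((M₁ + M₂ : ℕ) : ℝ) ≤ ((l₁ + l₂ : ℕ) : ℝ) * (q * (1 - α)) + ((h₁ + l₂ : ℕ) : ℝ) * (q * (α - β))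
      + ((h₁ + h₂ : ℕ) : ℝ) * (q * β) := by rw [emean]; exact hta
  have hl₁' : (l₁ : ℝ) < h₁ := by exact_mod_cast hl₁
  have hl₂' : (l₂ : ℝ) < h₂ := by exact_mod_cast hl₂
  have hl₁0 : (0 : ℝ) ≤ l₁ := Nat.cast_nonneg _
  have hα0 : 0 ≤ α := by nlinarith
  have hT₁le : q * ((l₁ : ℝ) + ((h₁ : ℝ) - l₁) * α) ≤ h₁ := gate_pairMean_le_hi q α l₁ h₁ hq0.le hq1 hα0 hα1 hl₁0 hl₁'.le
  by_cases h2a : q * T ≤ 2 * ((l₁ + l₂ : ℕ) : ℝ)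
  · exact fourAtom_decAt_of_bigLow y (M₁ + M₂) (l₁ + l₂) (h₁ + l₂) (h₁ + h₂) _ _ _ _ (by omega) (by omega) (by omega) (by omega)
      hZ hA hB hC hsum hy0 hy1 hta' (by rw [emean]; exact h2a)
  rw [not_le] at h2a
  -- the middle atom is not low: `q T ≤ 2(h₁ + l₂)`
  have hh₁0 : (0 : ℝ) ≤ h₁ := Nat.cast_nonneg _
  have h2c : q * T ≤ 2 * ((h₁ + l₂ : ℕ) : ℝ) := by rw [hT, mul_add]; push_cast; linarith
  by_cases hcomp : q * T < ((l₁ + l₂ : ℕ) : ℝ) + ((h₁ + l₂ : ℕ) : ℝ)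
  · -- the corner
    have hH1 : y ≤ q * (α - β) + q * β := by linarith
    obtain ⟨g, hg⟩ : ∃ g : ℝ, g = pairGate y (q * T) (l₁ + l₂) (h₁ + l₂) := ⟨_, rfl⟩
    have hk₁ : (0 : ℝ) < ((h₁ + l₂ : ℕ) : ℝ) - ((l₁ + l₂ : ℕ) : ℝ) := by push_cast; linarith
    have hρ0 : 0 < (q * T - 2 * ((l₁ + l₂ : ℕ) : ℝ)) / (((h₁ + l₂ : ℕ) : ℝ) - ((l₁ + l₂ : ℕ) : ℝ)) :=
      div_pos (by linarith) hk₁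
    have hρ1 : (q * T - 2 * ((l₁ + l₂ : ℕ) : ℝ)) / (((h₁ + l₂ : ℕ) : ℝ) - ((l₁ + l₂ : ℕ) : ℝ)) < 1 := by
      rw [div_lt_one hk₁]; linarith
    have hρa : (q * T - 2 * ((l₁ + l₂ : ℕ) : ℝ)) / (((h₁ + l₂ : ℕ) : ℝ) - ((l₁ + l₂ : ℕ) : ℝ)) ≤ q * α := by
      have := hl_rho_le q (q * α) (q * ((l₂ : ℝ) + ((h₂ : ℝ) - l₂) * β)) l₁ l₂ ((h₁ : ℝ) - l₁) (by linarith) hl₁0 (by linarith) h2l₂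
      have e1 : q * T - 2 * ((l₁ + l₂ : ℕ) : ℝ)
          = q * (l₁ : ℝ) + q * α * ((h₁ : ℝ) - l₁) + q * ((l₂ : ℝ) + ((h₂ : ℝ) - l₂) * β) - 2 * (l₁ : ℝ) - 2 * (l₂ : ℝ) := by
        rw [hT]; push_cast; ring
      have e2 : (((h₁ + l₂ : ℕ) : ℝ) - ((l₁ + l₂ : ℕ) : ℝ)) = (h₁ : ℝ) - l₁ := by push_cast; ring
      rw [e1, e2]; exact this
    have hg0 : 0 < g := by rw [hg, pairGate]; exact lt_of_lt_of_le hρ0 (le_max_left _ _)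
    have hg1 : g < 1 := by rw [hg, pairGate]; exact max_lt hρ1 (light_gate_lt_one y _ hy0 hy1 hρ1)
    have hga : g ≤ q * α := by rw [hg, pairGate]; exact hl_gate_le y (q * α) _ hy0.le hy1.le hα hρa
    have key : g * (y - q * β) ≤ y * (q * (α - β)) := by
      have := hl_corner_key y (q * α) (q * β) g hC hβl.le hα hga
      linarith
    have husage : usage y (((l₁ + l₂ : ℕ) : ℝ) * (q * (1 - α)) + ((h₁ + l₂ : ℕ) : ℝ) * (q * (α - β))
        + ((h₁ + h₂ : ℕ) : ℝ) * (q * β)) (h₁ + l₂) (l₁ + l₂) (h₁ + l₂) = g / (1 - g) := by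
      rw [emean, hg]
      have hng : ¬ (h₁ + l₂ + 1 ≤ h₁ + l₂) := by omega
      simp only [usage, gateOf, if_neg hng]
    have hC1 : y * ((1 - q) + q * (1 - α) - q * (α - β) / usage y (((l₁ + l₂ : ℕ) : ℝ) * (q * (1 - α))
        + ((h₁ + l₂ : ℕ) : ℝ) * (q * (α - β)) + ((h₁ + h₂ : ℕ) : ℝ) * (q * β)) (h₁ + l₂) (l₁ + l₂) (h₁ + l₂)) ≤ (1 - y) * (q * β) := by
      rw [husage]
      exact corner_C1_of_key y (1 - q) (q * (1 - α)) (q * (α - β)) (q * β) g hg0 hsum key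
    exact fourAtom_decAt_all_of_corner y (M₁ + M₂) (l₁ + l₂) (h₁ + l₂) (h₁ + h₂) _ _ _ _ (by omega) (by omega) (by omega)
      (by omega) hZ hA hB hC hsum hy0 hy1 hta' (by rw [emean]; exact h2a) (by rw [emean]; exact hcomp) hH1 hC1
  · -- `a + c ≤ qT` forces `qα = 1`: H3 holds trivially
    rw [not_lt] at hcomp
    have hqα : 1 ≤ q * α := by
      push_cast at hcomp
      rw [hT, mul_add] at hcomp
      exact hl_degenerate q α l₁ h₁ l₂ (q * ((l₂ : ℝ) + ((h₂ : ℝ) - l₂) * β)) hq1 hl₁0 hl₁' h2l₂ hcomp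
    have hH3 : y * ((1 - q) + q * (1 - α)) ≤ (1 - y) * (q * β) := by
      have h1 : (1 - q) + q * (1 - α) ≤ 0 := by linarith
      have h2 : y * ((1 - q) + q * (1 - α)) ≤ 0 := mul_nonpos_of_nonneg_of_nonpos hy0.le h1
      have h3 : 0 ≤ (1 - y) * (q * β) := mul_nonneg (by linarith) hC
      linarith
    exact fourAtom_decAt_all_of_incompatible y (M₁ + M₂) (l₁ + l₂) (h₁ + l₂) (h₁ + h₂) _ _ _ _ (by omega) (by omega) (by omega)
      (by omega) hZ hA hB hC hsum hy0 hy1 hta' (by rw [emean]; exact h2c) hH3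

/-! ### The small countermonotone law -/

/-- **the small `frCt` (`α + β ≤ 1`) of a heavy and a light admissible pair is admissible**: `TR[l₁+l₂, l₁+h₂, h₁+l₂; 1−α−β, β, α]`.
[this work] -/
theorem frCtSmall_gate_decAt_HL (y q α β : ℝ) (M₁ M₂ l₁ h₁ l₂ h₂ : ℕ) (hy0 : 0 < y) (hyq : y < q) (hq1 : q ≤ 1)
    (hl₁ : l₁ < h₁) (hh₁ : h₁ ≤ M₁) (hl₂ : l₂ < h₂) (hh₂ : h₂ ≤ M₂) (hβ0 : 0 ≤ β) (hβ1 : β ≤ 1)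
    (hα : y ≤ q * α) (hβl : q * β < y)
    (hta₁ : y * (M₁ : ℝ) ≤ q * ((l₁ : ℝ) + ((h₁ : ℝ) - l₁) * α)) (hta₂ : y * (M₂ : ℝ) ≤ q * ((l₂ : ℝ) + ((h₂ : ℝ) - l₂) * β))
    (hD₂ : ∀ j', j' < M₂ → DECAt y j' M₂ (gate (fun h => TP[l₂, h₂, β, h]) q)) (hsmall : α + β ≤ 1) :
    ∀ j', j' < M₁ + M₂ → DECAt y j' (M₁ + M₂) (gate (fun h => TR[l₁ + l₂, l₁ + h₂, h₁ + l₂, 1 - α - β, β, α, h]) q) := by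
  have hq0 : 0 < q := lt_trans hy0 hyq
  have hy1 : y < 1 := lt_of_lt_of_le hyq hq1
  have hα0 : 0 ≤ α := by nlinarith
  have h2l₂ := lightPair_two_lo_ge y q β M₂ l₂ h₂ hy1.le hl₂ hh₂ hβ0 hβ1 hβl hD₂
  have hl₂pos := lightPair_lo_pos y q β M₂ l₂ h₂ hy0 hl₂ hh₂ hβl hta₂
  obtain ⟨T, hT⟩ : ∃ T : ℝ, T = ((l₁ : ℝ) + ((h₁ : ℝ) - l₁) * α) + ((l₂ : ℝ) + ((h₂ : ℝ) - l₂) * β) := ⟨_, rfl⟩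
  have hta : y * ((M₁ + M₂ : ℕ) : ℝ) ≤ q * T := by rw [hT]; push_cast; linarith
  have hl₁' : (l₁ : ℝ) < h₁ := by exact_mod_cast hl₁
  have hl₂' : (l₂ : ℝ) < h₂ := by exact_mod_cast hl₂
  have hl₁0 : (0 : ℝ) ≤ l₁ := Nat.cast_nonneg _
  by_cases hord : l₁ + h₂ ≤ h₁ + l₂
  · -- heavy top `h₁ + l₂`
    exact triple_gate_decAt_of_heavyTop y q T (M₁ + M₂) (l₁ + l₂) (l₁ + h₂) (h₁ + l₂) (1 - α - β) β α hy0 hy1 hq0.le hq1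
      (by omega) hord (by omega) (by omega) (by linarith) hβ0 hα0 (by ring) (by rw [hT]; push_cast; ring) hα hta
  -- light top `l₁ + h₂`: reorder and use the criterion on `QD[a, h₁+l₂, l₁+h₂; 1−q, q(1−α−β), qα, qβ]`
  rw [not_le] at hord
  rw [TR_swap23]
  have e : gate (fun h => TR[l₁ + l₂, h₁ + l₂, l₁ + h₂, 1 - α - β, α, β, h]) q
      = fun h => QD[l₁ + l₂, h₁ + l₂, l₁ + h₂, 1 - q, q * (1 - α - β), q * α, q * β, h] := by
    funext h; simp only [gate]; split_ifs <;> ring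
  rw [e]
  have hZ : 0 ≤ 1 - q := by linarith
  have hA : 0 ≤ q * (1 - α - β) := mul_nonneg hq0.le (by linarith)
  have hB : 0 ≤ q * α := mul_nonneg hq0.le hα0
  have hC : 0 ≤ q * β := mul_nonneg hq0.le hβ0
  have hsum : (1 - q) + q * (1 - α - β) + q * α + q * β = 1 := by ring
  have emean : ((l₁ + l₂ : ℕ) : ℝ) * (q * (1 - α - β)) + ((h₁ + l₂ : ℕ) : ℝ) * (q * α) + ((l₁ + h₂ : ℕ) : ℝ) * (q * β)
      = q * T := by rw [hT]; push_cast; ring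
  have hta' : y * ((M₁ + M₂ : ℕ) : ℝ) ≤ ((l₁ + l₂ : ℕ) : ℝ) * (q * (1 - α - β)) + ((h₁ + l₂ : ℕ) : ℝ) * (q * α)
      + ((l₁ + h₂ : ℕ) : ℝ) * (q * β) := by rw [emean]; exact hta
  by_cases h2a : q * T ≤ 2 * ((l₁ + l₂ : ℕ) : ℝ)
  · exact fourAtom_decAt_of_bigLow y (M₁ + M₂) (l₁ + l₂) (h₁ + l₂) (l₁ + h₂) _ _ _ _ (by omega) (by omega) hord
      (by omega) hZ hA hB hC hsum hy0 hy1 hta' (by rw [emean]; exact h2a)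
  rw [not_le] at h2a
  have hα1 : α ≤ 1 := by linarith
  have hT₁le : q * ((l₁ : ℝ) + ((h₁ : ℝ) - l₁) * α) ≤ h₁ := gate_pairMean_le_hi q α l₁ h₁ hq0.le hq1 hα0 hα1 hl₁0 hl₁'.le
  have hh₁0 : (0 : ℝ) ≤ h₁ := Nat.cast_nonneg _
  have h2c : q * T ≤ 2 * ((h₁ + l₂ : ℕ) : ℝ) := by rw [hT, mul_add]; push_cast; linarith
  by_cases hcomp : q * T < ((l₁ + l₂ : ℕ) : ℝ) + ((h₁ + l₂ : ℕ) : ℝ)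
  · have hH1 : y ≤ q * α + q * β := by linarith
    obtain ⟨g, hg⟩ : ∃ g : ℝ, g = pairGate y (q * T) (l₁ + l₂) (h₁ + l₂) := ⟨_, rfl⟩
    have hk₁ : (0 : ℝ) < ((h₁ + l₂ : ℕ) : ℝ) - ((l₁ + l₂ : ℕ) : ℝ) := by push_cast; linarith
    have hρ0 : 0 < (q * T - 2 * ((l₁ + l₂ : ℕ) : ℝ)) / (((h₁ + l₂ : ℕ) : ℝ) - ((l₁ + l₂ : ℕ) : ℝ)) :=
      div_pos (by linarith) hk₁
    have hρ1 : (q * T - 2 * ((l₁ + l₂ : ℕ) : ℝ)) / (((h₁ + l₂ : ℕ) : ℝ) - ((l₁ + l₂ : ℕ) : ℝ)) < 1 := by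
      rw [div_lt_one hk₁]; linarith
    have hρa : (q * T - 2 * ((l₁ + l₂ : ℕ) : ℝ)) / (((h₁ + l₂ : ℕ) : ℝ) - ((l₁ + l₂ : ℕ) : ℝ)) ≤ q * α := by
      have := hl_rho_le q (q * α) (q * ((l₂ : ℝ) + ((h₂ : ℝ) - l₂) * β)) l₁ l₂ ((h₁ : ℝ) - l₁) (by linarith) hl₁0 (by linarith) h2l₂
      have e1 : q * T - 2 * ((l₁ + l₂ : ℕ) : ℝ)
          = q * (l₁ : ℝ) + q * α * ((h₁ : ℝ) - l₁) + q * ((l₂ : ℝ) + ((h₂ : ℝ) - l₂) * β) - 2 * (l₁ : ℝ) - 2 * (l₂ : ℝ) := by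
        rw [hT]; push_cast; ring
      have e2 : (((h₁ + l₂ : ℕ) : ℝ) - ((l₁ + l₂ : ℕ) : ℝ)) = (h₁ : ℝ) - l₁ := by push_cast; ring
      rw [e1, e2]; exact this
    have hg0 : 0 < g := by rw [hg, pairGate]; exact lt_of_lt_of_le hρ0 (le_max_left _ _)
    have hg1 : g < 1 := by rw [hg, pairGate]; exact max_lt hρ1 (light_gate_lt_one y _ hy0 hy1 hρ1)
    have hga : g ≤ q * α := by rw [hg, pairGate]; exact hl_gate_le y (q * α) _ hy0.le hy1.le hα hρa
    have key : g * (y - q * β) ≤ y * (q * α) := by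
      have := hl_corner_key y (q * α) (q * β) g hC hβl.le hα hga
      have h0 : 0 ≤ y * (q * β) := mul_nonneg hy0.le hC
      linarith
    have husage : usage y (((l₁ + l₂ : ℕ) : ℝ) * (q * (1 - α - β)) + ((h₁ + l₂ : ℕ) : ℝ) * (q * α)
        + ((l₁ + h₂ : ℕ) : ℝ) * (q * β)) (h₁ + l₂) (l₁ + l₂) (h₁ + l₂) = g / (1 - g) := by
      rw [emean, hg]
      have hng : ¬ (h₁ + l₂ + 1 ≤ h₁ + l₂) := by omega
      simp only [usage, gateOf, if_neg hng]
    have hC1 : y * ((1 - q) + q * (1 - α - β) - q * α / usage y (((l₁ + l₂ : ℕ) : ℝ) * (q * (1 - α - β))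
        + ((h₁ + l₂ : ℕ) : ℝ) * (q * α) + ((l₁ + h₂ : ℕ) : ℝ) * (q * β)) (h₁ + l₂) (l₁ + l₂) (h₁ + l₂)) ≤ (1 - y) * (q * β) := by
      rw [husage]
      exact corner_C1_of_key y (1 - q) (q * (1 - α - β)) (q * α) (q * β) g hg0 hsum key
    exact fourAtom_decAt_all_of_corner y (M₁ + M₂) (l₁ + l₂) (h₁ + l₂) (l₁ + h₂) _ _ _ _ (by omega) (by omega) hord (by omega)
      hZ hA hB hC hsum hy0 hy1 hta' (by rw [emean]; exact h2a) (by rw [emean]; exact hcomp) hH1 hC1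
  · rw [not_lt] at hcomp
    have hqα : 1 ≤ q * α := by
      push_cast at hcomp
      rw [hT, mul_add] at hcomp
      exact hl_degenerate q α l₁ h₁ l₂ (q * ((l₂ : ℝ) + ((h₂ : ℝ) - l₂) * β)) hq1 hl₁0 hl₁' h2l₂ hcomp
    have hH3 : y * ((1 - q) + q * (1 - α - β)) ≤ (1 - y) * (q * β) := by
      have h1 : (1 - q) + q * (1 - α - β) ≤ 0 := by nlinarith [mul_nonneg hq0.le hβ0]
      have h2 : y * ((1 - q) + q * (1 - α - β)) ≤ 0 := mul_nonpos_of_nonneg_of_nonpos hy0.le h1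
      have h3 : 0 ≤ (1 - y) * (q * β) := mul_nonneg (by linarith) hC
      linarith
    exact fourAtom_decAt_all_of_incompatible y (M₁ + M₂) (l₁ + l₂) (h₁ + l₂) (l₁ + h₂) _ _ _ _ (by omega) (by omega) hord
      (by omega) hZ hA hB hC hsum hy0 hy1 hta' (by rw [emean]; exact h2c) hH3

/-! ### The big countermonotone law -/

/-- **the big `frCt` (`1 ≤ α + β`) of a heavy and a light admissible pair is admissible**: `TR[l₁+h₂, h₁+l₂, h₁+h₂; 1−α, 1−β, α+β−1]`.
[this work] -/
theorem frCtBig_gate_decAt_HL (y q α β : ℝ) (M₁ M₂ l₁ h₁ l₂ h₂ : ℕ) (hy0 : 0 < y) (hyq : y < q) (hq1 : q ≤ 1)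
    (hl₁ : l₁ < h₁) (hh₁ : h₁ ≤ M₁) (hl₂ : l₂ < h₂) (hh₂ : h₂ ≤ M₂) (hα1 : α ≤ 1) (hβ0 : 0 ≤ β) (hβ1 : β ≤ 1)
    (hα : y ≤ q * α) (hβl : q * β < y)
    (hta₁ : y * (M₁ : ℝ) ≤ q * ((l₁ : ℝ) + ((h₁ : ℝ) - l₁) * α)) (hta₂ : y * (M₂ : ℝ) ≤ q * ((l₂ : ℝ) + ((h₂ : ℝ) - l₂) * β))
    (hD₂ : ∀ j', j' < M₂ → DECAt y j' M₂ (gate (fun h => TP[l₂, h₂, β, h]) q)) (hbig : 1 ≤ α + β) :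
    ∀ j', j' < M₁ + M₂ → DECAt y j' (M₁ + M₂) (gate (fun h => TR[l₁ + h₂, h₁ + l₂, h₁ + h₂, 1 - α, 1 - β, α + β - 1, h]) q) := by
  have hq0 : 0 < q := lt_trans hy0 hyq
  have hy1 : y < 1 := lt_of_lt_of_le hyq hq1
  have h2l₂ := lightPair_two_lo_ge y q β M₂ l₂ h₂ hy1.le hl₂ hh₂ hβ0 hβ1 hβl hD₂
  obtain ⟨k₁, rfl⟩ : ∃ k₁, h₁ = l₁ + k₁ := ⟨h₁ - l₁, by omega⟩
  obtain ⟨k₂, rfl⟩ : ∃ k₂, h₂ = l₂ + k₂ := ⟨h₂ - l₂, by omega⟩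
  have hk₁ : 1 ≤ k₁ := by omega
  have hk₂ : 1 ≤ k₂ := by omega
  have hta : y * ((M₁ + M₂ : ℕ) : ℝ) ≤ q * (((l₁ + l₂ : ℕ) : ℝ) + α * k₁ + β * k₂) := by
    have := add_le_add hta₁ hta₂
    push_cast at this ⊢
    linarith
  rcases lt_or_ge k₂ k₁ with hlt | hge
  · -- `k₂ < k₁`: normal form with the large spread `k₁` carrying the heavy gate `α`
    have e1 : (fun h : ℕ => TR[l₁ + (l₂ + k₂), l₁ + k₁ + l₂, l₁ + k₁ + (l₂ + k₂), 1 - α, 1 - β, α + β - 1, h])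
        = fun h => TR[(l₁ + l₂) + k₂, (l₁ + l₂) + k₁, (l₁ + l₂) + k₂ + k₁, 1 - α, 1 - β, α + β - 1, h] := by
      funext h
      rw [show l₁ + (l₂ + k₂) = (l₁ + l₂) + k₂ by omega, show l₁ + k₁ + l₂ = (l₁ + l₂) + k₁ by omega,
        show l₁ + k₁ + (l₂ + k₂) = (l₁ + l₂) + k₂ + k₁ by omega]
    rw [e1]
    exact frCtBig_gate_decAt_core y q α β (M₁ + M₂) (l₁ + l₂) k₂ k₁ hy0 hyq hq1 hα hα1 hβ0 hβ1 hbig hk₂ hlt (by omega) hta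
  · -- `k₁ ≤ k₂`: every atom is at least `h₁ + l₂`, which is not low
    have h2c : q * (((l₁ : ℝ) + (((l₁ + k₁ : ℕ) : ℝ) - l₁) * α) + ((l₂ : ℝ) + (((l₂ + k₂ : ℕ) : ℝ) - l₂) * β))
        ≤ 2 * ((l₁ + k₁ + l₂ : ℕ) : ℝ) := by
      push_cast at h2l₂ ⊢
      have hk₁0 : (0 : ℝ) ≤ k₁ := Nat.cast_nonneg _
      have hl₁0 : (0 : ℝ) ≤ l₁ := Nat.cast_nonneg _
      have hα0 : 0 ≤ α := by nlinarith
      nlinarith [mul_nonneg hk₁0 hα0, mul_le_mul_of_nonneg_left hα1 hk₁0]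
    have hge' : (k₁ : ℝ) ≤ k₂ := by exact_mod_cast hge
    refine triple_gate_decAt_of_noLow y q _ (M₁ + M₂) _ _ _ _ _ _ hy0 hy1 hq0.le hq1 (by omega) (by omega) (by omega)
      (by linarith) (by linarith) (by linarith) (by ring) (by push_cast; ring) ?_ ?_ h2c ?_
    · have := add_le_add hta₁ hta₂; push_cast at this ⊢; linarith
    · push_cast at h2c ⊢; linarith
    · push_cast at h2c ⊢
      have hk₂0 : (0 : ℝ) ≤ k₂ := Nat.cast_nonneg _
      linarith

end LawDec

end Quant

end Summit.CriticalPhenomena.PercolationContinuityZ3.Theorems
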